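import Literature.NumberTheory.LFunctions.InvLFunctionLinnikBox
import Literature.NumberTheory.LFunctions.MoebiusCharacterSumData
import HarnessLib

/-!
# `1/L(s, χ)` on a Linnik contour: the three pointwise bounds and the bookkeeping of exponents

Topic `Literature/NumberTheory/LFunctions`. Everything in this file is PROVED.

Pointwise majorants for `F = 1/L(·, χ)` (`χ ≠ χ₀` mod `q`) on the boundary of the rectangle
`[1 − η/2, c] × [−T, T]` used to move the Perron contour for `∑_{n ≤ N} χ(n)μ(n)` into a zero-free
"Linnik box" `Re s > 1 − η` (Iwaniec–Kowalski §18.2; Montgomery–Vaughan §6.2 for the classical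
width), all derived from the Borel–Carathéodory bound of
`InvLFunctionDisc.norm_inv_LFunction_le_exp_of_line` (`InvLFunctionLinnikBox.lean`). With
`M_t = 2 + η log q + log(|t| + 2) + log(log q + 5) ≤ M`, `c_η = log(2/(aη)) + π ≤ C`:

* `norm_inv_left_le` — on the left edge: `‖F(1 − η/2 + it)‖ ≤ exp((4a + 2)M + 4C)`;
* `norm_inv_mul_rpow_le` — on `1 − η/2 ≤ σ ≤ 1 + aη`: `‖F(σ + it)‖ x^σ ≤ x · exp(aη log x + 4C)`
  as soon as `log x ≥ 4M/η` (the decay of `x^σ` beats the growth of `1/L` — Linnik's mechanism);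
* `norm_inv_mul_rpow_le_of_gt` — on `σ ≥ 1 + aη` trivially (`‖F‖ ≤ σ/(σ−1) ≤ 2/(aη) ≤ e^C`).

`numerics` collects, for the parameter choice `K = 200B + 1000`, `H = 3B + 12`, `a = 1/1000`,
`η = K log L/L`, `T = L^H/2` (`L = log x`), the finitely many eventual inequalities in `log L`
that the assembly (`MoebiusCharSumLinnikBox.lean`) consumes.

## References

* [IwaniecKowalski2004] H. Iwaniec, E. Kowalski, *Analytic Number Theory*, AMS 2004, §18.2.
* [MontgomeryVaughan2007] H. L. Montgomery, R. C. Vaughan, *Multiplicative Number Theory I*,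
  CUP 2007, §6.2.
* [Titchmarsh1986] E. C. Titchmarsh, *The Theory of the Riemann Zeta-Function*, §3.11–§3.12.
-/

noncomputable section

open Complex Filter Topology Metric Set
open scoped ArithmeticFunction.Moebius

namespace Literature.NumberTheory.LFunctions

namespace MoebiusCharSumLinnikBox

variable {q : ℕ} [NeZero q] (χ : DirichletCharacter ℂ q)

/-- **Left edge.** For `χ ≠ χ₀`, `0 < η ≤ 1/4`, `0 < a ≤ 1/4`, the disc at height `t` zero-free,
`M_t ≤ M`, `c_η ≤ C`: `‖L(1 − η/2 + it, χ)⁻¹‖ ≤ exp((4a + 2)M + 4C)`.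
[cite: Titchmarsh1986, §3.11 (proof of Theorem 3.11)] -/
theorem norm_inv_left_le (hχ : χ ≠ 1) {η a t M C : ℝ} (hη0 : 0 < η) (hη : η ≤ 1 / 4)
    (ha0 : 0 < a) (ha : a ≤ 1 / 4)
    (hzero : ∀ w : ℂ, ‖w - (1 + a * η + t * I)‖ < (1 + a) * η → w.re < 1 → χ.LFunction w ≠ 0)
    (hM : 2 + η * Real.log q + Real.log (|t| + 2) + Real.log (Real.log q + 5) ≤ M)
    (hC : Real.log (2 / (a * η)) + Real.pi ≤ C) :
    ‖(χ.LFunction ((1 - η / 2 : ℝ) + t * I))⁻¹‖ ≤ Real.exp ((4 * a + 2) * M + 4 * C) := by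
  have h := InvLFunctionDisc.norm_inv_LFunction_le_exp_of_line χ hχ hη0 hη ha0 ha hzero
    (σ := 1 - η / 2) le_rfl (by nlinarith)
  refine h.trans ?_
  rw [Real.exp_le_exp]
  have hlt2 : 0 < Real.log (|t| + 2) := Real.log_pos (by linarith [abs_nonneg t])
  have hq1 : (1 : ℝ) ≤ q := by exact_mod_cast NeZero.one_le
  have hlq5 : 0 < Real.log (Real.log q + 5) := Real.log_pos (by linarith [Real.log_nonneg hq1])
  have hM0 : 0 ≤ 2 + η * Real.log q + Real.log (|t| + 2) + Real.log (Real.log q + 5) := by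
    have := mul_nonneg hη0.le (Real.log_nonneg hq1); positivity
  have e : 4 * (2 + η * Real.log q + Real.log (|t| + 2) + Real.log (Real.log q + 5)) *
      (1 + a * η - (1 - η / 2)) / η =
      (4 * a + 2) * (2 + η * Real.log q + Real.log (|t| + 2) + Real.log (Real.log q + 5)) := by
    field_simp; ring
  rw [e]
  have h4a : 0 ≤ 4 * a + 2 := by linarith
  nlinarith [mul_le_mul_of_nonneg_left hM h4a]

/-- **Horizontal edges, `σ ≤ 1 + aη`.** Under the same hypotheses, for `x > 0` with
`log x ≥ 4M/η` and `1 − η/2 ≤ σ ≤ 1 + aη`: `‖L(σ + it, χ)⁻¹‖ · x^σ ≤ x · exp(aη log x + 4C)`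
(the exponent `4M(1 + aη − σ)/η` of the Borel–Carathéodory bound is paid for by
`x^σ = x · x^{aη} · x^{−(1 + aη − σ)}`). [cite: IwaniecKowalski2004, §18.2] -/
theorem norm_inv_mul_rpow_le (hχ : χ ≠ 1) {η a t M C x : ℝ} (hη0 : 0 < η) (hη : η ≤ 1 / 4)
    (ha0 : 0 < a) (ha : a ≤ 1 / 4)
    (hzero : ∀ w : ℂ, ‖w - (1 + a * η + t * I)‖ < (1 + a) * η → w.re < 1 → χ.LFunction w ≠ 0)
    (hM : 2 + η * Real.log q + Real.log (|t| + 2) + Real.log (Real.log q + 5) ≤ M)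
    (hC : Real.log (2 / (a * η)) + Real.pi ≤ C) (hx : 0 < x) (hlog : 4 * M / η ≤ Real.log x)
    {σ : ℝ} (hσ1 : 1 - η / 2 ≤ σ) (hσ2 : σ ≤ 1 + a * η) :
    ‖(χ.LFunction (σ + t * I))⁻¹‖ * x ^ σ ≤ x * Real.exp (a * η * Real.log x + 4 * C) := by
  have h := InvLFunctionDisc.norm_inv_LFunction_le_exp_of_line χ hχ hη0 hη ha0 ha hzero hσ1 hσ2
  set Mt := 2 + η * Real.log q + Real.log (|t| + 2) + Real.log (Real.log q + 5) with hMt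
  have hlt2 : 0 < Real.log (|t| + 2) := Real.log_pos (by linarith [abs_nonneg t])
  have hq1 : (1 : ℝ) ≤ q := by exact_mod_cast NeZero.one_le
  have hlq5 : 0 < Real.log (Real.log q + 5) := Real.log_pos (by linarith [Real.log_nonneg hq1])
  have hM0 : 0 ≤ Mt := by have := mul_nonneg hη0.le (Real.log_nonneg hq1); positivity
  have hxσ : x ^ σ = x * Real.exp ((σ - 1) * Real.log x) := by
    rw [Real.rpow_def_of_pos hx, show Real.log x * σ = Real.log x + (σ - 1) * Real.log x by ring,
      Real.exp_add, Real.exp_log hx]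
  rw [hxσ]
  have hexp0 : 0 ≤ Real.exp ((σ - 1) * Real.log x) := (Real.exp_pos _).le
  calc ‖(χ.LFunction (σ + t * I))⁻¹‖ * (x * Real.exp ((σ - 1) * Real.log x))
      ≤ Real.exp (4 * Mt * (1 + a * η - σ) / η + 4 * (Real.log (2 / (a * η)) + Real.pi)) *
          (x * Real.exp ((σ - 1) * Real.log x)) :=
        mul_le_mul_of_nonneg_right h (by positivity)
    _ = x * Real.exp (4 * Mt * (1 + a * η - σ) / η + 4 * (Real.log (2 / (a * η)) + Real.pi) +
          (σ - 1) * Real.log x) := by rw [Real.exp_add _ ((σ - 1) * Real.log x)]; ring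
    _ ≤ x * Real.exp (a * η * Real.log x + 4 * C) := by
        refine mul_le_mul_of_nonneg_left (Real.exp_le_exp.2 ?_) hx.le
        -- `u (4 Mt/η − log x) ≤ 0` with `u = 1 + aη − σ ≥ 0`
        have hu : 0 ≤ 1 + a * η - σ := by linarith
        have hMtM : 4 * Mt / η ≤ 4 * M / η := by
          rw [div_le_div_iff_of_pos_right hη0]; linarith
        have hkey : 4 * Mt * (1 + a * η - σ) / η ≤ (1 + a * η - σ) * Real.log x := by
          rw [show 4 * Mt * (1 + a * η - σ) / η = (1 + a * η - σ) * (4 * Mt / η) by ring]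
          exact mul_le_mul_of_nonneg_left (hMtM.trans hlog) hu
        nlinarith

/-- **Horizontal edges, `σ > 1 + aη`.** For `Re s = σ ≥ 1 + aη` (`0 < aη ≤ 1`):
`‖L(σ + it, χ)⁻¹‖ ≤ 2/(aη)` (`1/L = ∑ χμ n^{-s}`, `|·| ≤ ζ(σ) ≤ σ/(σ−1)`). [folklore] -/
theorem norm_inv_le_of_gt {η a t σ : ℝ} (haη0 : 0 < a * η) (haη1 : a * η ≤ 1)
    (hσ : 1 + a * η ≤ σ) : ‖(χ.LFunction (σ + t * I))⁻¹‖ ≤ 2 / (a * η) := by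
  have hs : 1 < ((σ : ℂ) + t * I).re := by simp; linarith
  rw [← MoebiusTwist.LSeries_twist_moebius_eq_inv χ hs]
  have h := ZetaClassicalRegion.norm_LSeries_le_of_norm_le_one
    (f := fun n : ℕ ↦ χ (n : ZMod q) * (μ n : ℂ)) (fun n ↦ ?_) hs
  · refine h.trans ?_
    simp only [add_re, ofReal_re, mul_re, I_re, mul_zero, ofReal_im, I_im, mul_one, sub_self,
      add_zero]
    rw [div_le_div_iff₀ (by linarith) haη0]
    nlinarith
  · rw [norm_mul, Complex.norm_intCast]
    calc ‖χ (n : ZMod q)‖ * |(μ n : ℝ)| ≤ 1 * 1 := by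
          gcongr
          · exact DirichletCharacter.norm_le_one χ _
          · exact_mod_cast ArithmeticFunction.abs_moebius_le_one
      _ = 1 := one_mul _

omit [NeZero q] in
/-- The coefficients `χ(n)μ(n)` are bounded by `1`. [folklore] -/
theorem norm_twist_moebius_le (n : ℕ) : ‖χ (n : ZMod q) * (μ n : ℂ)‖ ≤ 1 := by
  rw [norm_mul, Complex.norm_intCast]
  calc ‖χ (n : ZMod q)‖ * |(μ n : ℝ)| ≤ 1 * 1 := by
        gcongr
        · exact DirichletCharacter.norm_le_one χ _
        · exact_mod_cast ArithmeticFunction.abs_moebius_le_one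
    _ = 1 := one_mul _

omit [NeZero q] in
/-- Geometry: a point of the disc `‖w − (1 + aη + it)‖ < (1 + a)η` has `|Im w| < |t| + (1 + a)η`.
[folklore] -/
theorem abs_im_lt_of_mem_disc {η a t : ℝ} {w : ℂ} (hw : ‖w - (1 + a * η + t * I)‖ < (1 + a) * η) :
    |w.im| < |t| + (1 + a) * η := by
  have h := abs_im_le_norm (w - (1 + a * η + t * I))
  have him : (w - (1 + a * η + t * I)).im = w.im - t := by simp
  rw [him] at h
  have := abs_sub_abs_le_abs_sub w.im t
  linarith

/-! ### The eventual inequalities -/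

/-- `exp 8 ≥ 2000` and `log 2000 ≤ 8`. [folklore] -/
theorem log_two_thousand_le : Real.log 2000 ≤ 8 := by
  have he : (2000 : ℝ) ≤ Real.exp 8 := by
    have h1 := Real.exp_one_gt_d9
    have h8 : Real.exp 8 = Real.exp 1 ^ 8 := by rw [← Real.exp_nat_mul]; norm_num
    rw [h8]
    have : (2.7182818283 : ℝ) ^ 8 ≤ Real.exp 1 ^ 8 := by gcongr
    nlinarith
  calc Real.log 2000 ≤ Real.log (Real.exp 8) := Real.log_le_log (by norm_num) he
    _ = 8 := Real.log_exp 8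

/-- **Bookkeeping.** With `K = 200B + 1000`, `H = 3B + 12` (`B ≥ 0`), `K₀ > 0`, and
`ℓ ≥ 16K + 5K₀ + 420`, `L = e^ℓ`: the parameters `η = Kℓ/L ∈ (0, 1/4]`, and all the eventual
inequalities consumed by the contour argument hold. [folklore] -/
theorem numerics {B K H K₀ ℓ L : ℝ} (hB : 0 ≤ B) (hK : K = 200 * B + 1000) (hH : H = 3 * B + 12)
    (hK₀ : 0 < K₀) (hℓ : 16 * K + 5 * K₀ + 420 ≤ ℓ) (hL : L = Real.exp ℓ) :
    16 ≤ L ∧ (0 < K * ℓ / L ∧ K * ℓ / L ≤ 1 / 4) ∧ 5 ≤ K * ℓ ∧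
      Real.log (Real.exp (H * ℓ) / 2 + 2) ≤ H * ℓ ∧ Real.log (L / 16 + 5) ≤ ℓ ∧
      Real.log (2 / (1 / 1000 * (K * ℓ / L))) + Real.pi ≤ ℓ + 12 ∧
      10 * (2 + K * ℓ / 16 + H * ℓ + ℓ) ≤ K * ℓ ∧ 5 * K₀ ≤ L ∧
      H * ℓ + (4 * (1 / 1000) + 2) * (2 + K * ℓ / 16 + H * ℓ + ℓ) + 4 * (ℓ + 12) -
          K * ℓ / 5 + (B + 1) * ℓ ≤ 0 ∧
      Real.log (2 * K * ℓ) - ℓ + 21 / 10 * (1 / 1000) * K * ℓ + 4 * (ℓ + 12) - H * ℓ +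
          (B + 1) * ℓ ≤ 0 := by
  have hK1000 : 1000 ≤ K := by rw [hK]; linarith
  have hK0 : 0 < K := by linarith
  have hℓK : 16 * K ≤ ℓ := by linarith
  have hℓ1 : 16420 ≤ ℓ := by linarith
  have hℓ0 : 0 < ℓ := by linarith
  have hL1 : ℓ + 1 ≤ L := by rw [hL]; exact Real.add_one_le_exp ℓ
  have hL0 : 0 < L := by linarith
  have hLsq : ℓ ^ 2 / 4 ≤ L := by
    have h := Real.add_one_le_exp (ℓ / 2)
    have h2 : Real.exp ℓ = Real.exp (ℓ / 2) * Real.exp (ℓ / 2) := by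
      rw [← Real.exp_add]; ring_nf
    rw [hL, h2]; nlinarith [Real.exp_pos (ℓ / 2)]
  have hKℓ : 5 ≤ K * ℓ := by nlinarith
  have hBℓ : 0 ≤ B * ℓ := mul_nonneg hB hℓ0.le
  refine ⟨by linarith, ⟨by positivity, ?_⟩, hKℓ, ?_, ?_, ?_, ?_, by linarith, ?_, ?_⟩
  · -- `η ≤ 1/4`
    rw [div_le_iff₀ hL0]
    nlinarith
  · -- `log(T + 2) ≤ Hℓ`
    have hH1 : 12 ≤ H := by rw [hH]; linarith
    have hHℓ : 3 ≤ H * ℓ := by nlinarith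
    have h4 : 4 ≤ Real.exp (H * ℓ) := by have := Real.add_one_le_exp (H * ℓ); linarith
    calc Real.log (Real.exp (H * ℓ) / 2 + 2) ≤ Real.log (Real.exp (H * ℓ)) :=
          Real.log_le_log (by positivity) (by linarith)
      _ = H * ℓ := Real.log_exp _
  · -- `log(L/16 + 5) ≤ ℓ`
    calc Real.log (L / 16 + 5) ≤ Real.log L := Real.log_le_log (by positivity) (by linarith)
      _ = ℓ := by rw [hL, Real.log_exp]
  · -- `c_η ≤ ℓ + 12`
    have hη0 : 0 < K * ℓ / L := by positivity
    have h1 : 2 / (1 / 1000 * (K * ℓ / L)) ≤ 2000 * L := by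
      rw [div_le_iff₀ (by positivity)]
      have : 2000 * L * (1 / 1000 * (K * ℓ / L)) = 2 * (K * ℓ) := by field_simp; ring
      rw [this]; linarith
    have h2 : Real.log (2 / (1 / 1000 * (K * ℓ / L))) ≤ 8 + ℓ := by
      calc Real.log (2 / (1 / 1000 * (K * ℓ / L))) ≤ Real.log (2000 * L) :=
            Real.log_le_log (by positivity) h1
        _ = Real.log 2000 + ℓ := by rw [Real.log_mul (by norm_num) hL0.ne', hL, Real.log_exp]
        _ ≤ 8 + ℓ := by linarith [log_two_thousand_le]
    linarith [Real.pi_le_four]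
  · -- `10 M* ≤ Kℓ`
    rw [hK, hH] at *
    nlinarith
  · -- the left-edge exponent
    rw [hK, hH]
    nlinarith
  · -- the horizontal exponent
    have hlog : Real.log (2 * K * ℓ) ≤ 2 * K + ℓ - 2 := by
      rw [Real.log_mul (by positivity) hℓ0.ne']
      have h1 := Real.log_le_sub_one_of_pos (show (0 : ℝ) < 2 * K by positivity)
      have h2 := Real.log_le_sub_one_of_pos hℓ0
      linarith
    have hmain : 2 * K + ℓ - 2 - ℓ + 21 / 10 * (1 / 1000) * K * ℓ + 4 * (ℓ + 12) - H * ℓ +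
        (B + 1) * ℓ ≤ 0 := by
      rw [hK, hH]
      rw [hK] at hℓK
      nlinarith [mul_nonneg hB hB]
    linarith

end MoebiusCharSumLinnikBox

end Literature.NumberTheory.LFunctions

end
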